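import Mathlib
import HarnessLib
import Summits.NavierStokesRegularity.NavierStokesRegularity.Theorems.HalfSpaceWindowDoorCirculationCarryingRigidityGaussSwirlLaw

/-!
# Route `HalfSpaceWindowDoor`, crux `CirculationCarryingRigidity` (stmt-NavierStokesRegularity-25311) —
# stratum R_κ «SUB-EXTREMAL INFLOW»: `ℐ ≥ −κ𝒢` about one axis in the far past, `κ < 2` ⇒ poloidal (sharp: the extremal enemy has `ℐ = −2𝒢`)

LEAD ns-hsw-p1 g7 (cell pub-ns-dss), `--supports stmt-NavierStokesRegularity-25311 --as helper`; line `gauss_swirl` × `blowdown`.  The rung R of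
`gauss_swirl` (`noInflowStratum_holds`: no Gaussian-mean inflow `ℐ ≥ 0` about one space–time axis before some epoch ⇒ poloidal) is the case
`κ = 0` of a one-parameter family.  From the swirl law O1 `d𝒢/ds = −𝒢/(s₀−s) − ℐ/(2(s₀−s))`, the hypothesis `ℐ ≥ −κ𝒢` gives
`d𝒢/ds ≤ −(1 − κ/2)𝒢/(s₀−s)`, so `𝒢·(s₀−s)^{−(1−κ/2)}` is non-increasing in `s`, non-negative (O2), and tends to `0` at `−∞` (O3, `κ < 2`):
hence `𝒢 ≡ 0` on the ray and the profile is poloidal.  The threshold `κ = 2` is exactly the MAXIMAL-INFLOW IDENTITY `ℐ = −2𝒢` of the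
Gaussian-extremal normal form (`…GaussExtremal.exists_gaussExtremal`), so the row is sharp within the method.

* `farPast_eq_zero_of_ratio` — the ODE lemma (`G' = −G/(s₀−s) − I/(2(s₀−s))`, `G ≥ 0`, `I ≥ −κG`, `κ < 2`, `G` bounded far back ⇒ `G ≡ 0`).
* `poloidal_of_subExtremalInflow` — **CENSUS ROW R_κ**: closed hemisphere + one space–time axis `(x₀, s₀)`, an epoch `s₁` and `κ < 2` with
  `ℐ(s₀−s; x₀)[v(s)] ≥ −κ·𝒢(s₀−s; x₀)[v(s)]` for all `s < s₁` ⇒ `⟪curl v, e₃⟫ ≡ 0` on the whole slab.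
* `enemy_inflowRatio_dips` — contrapositive: for an enemy of W6, about EVERY space–time axis and for EVERY `κ < 2`, at arbitrarily early
  times `ℐ < −κ𝒢`: the inflow ratio `ℐ/𝒢` dips below every level `> −2` infinitely often in the far past, about every axis
  (`liminf_{s→−∞} ℐ/𝒢 ≤ −2`), while the extremal enemy realises `ℐ/𝒢 = −2` exactly at its extremal point.

WHAT THIS IS NOT: not a statement about Navier–Stokes regularity; door statements concern HYPOTHETICAL blow-up profiles.  No item is
closed by this file.
-/

noncomputable section

-- the summit and its single sub-problem share the name (CONVENTIONS §1), as in every Theorems file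
set_option linter.dupNamespace false

namespace Summit.NavierStokesRegularity.NavierStokesRegularity.Theorems.HalfSpaceWindowDoorCirculationCarryingRigidityGaussSubExtremal

open MeasureTheory Set Function Filter Topology
open scoped RealInnerProductSpace InnerProductSpace
open Literature.Analysis Literature.Analysis.FluidPDE
open Summit.NavierStokesRegularity.NavierStokesRegularity.Theses.HalfSpaceWindowDoor
open Summit.NavierStokesRegularity.NavierStokesRegularity.Theorems.HalfSpaceWindowDoorCirculationCarryingRigidityDefs
open Summit.NavierStokesRegularity.NavierStokesRegularity.Theorems.HalfSpaceWindowDoorCirculationCarryingRigidityGaussSwirlLaw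
  (gaussianSwirlLaw_holds)
open Summit.NavierStokesRegularity.NavierStokesRegularity.Theorems.HalfSpaceWindowDoorCirculationCarryingRigidityGaussCirculation
  (gaussianCirculation_holds gaussianBound_holds)
open Summit.NavierStokesRegularity.NavierStokesRegularity.Theorems.HalfSpaceWindowDoorCirculationCarryingRigidityCriticalStretchingAnalytic
  (inner_curl_e3_eq_zero_of_far_past)

variable {C : ℝ}

/-- **Far-past ODE lemma with a ratio bound.**  If `G ≥ 0` solves `G' = −G/(s₀−s) − I/(2(s₀−s))` on `(−∞, s₁)` (`s₁ ≤ s₀`) with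
`I ≥ −κG` there for some `κ < 2`, and `G` is bounded on some far-past ray, then `G ≡ 0` on `(−∞, s₁)`: with `β = 1 − κ/2 > 0` the
function `Φ = G·(s₀−s)^{−β}` is non-negative, non-increasing (`Φ' ≤ 0`) and tends to `0` at `−∞`. -/
theorem farPast_eq_zero_of_ratio {G I : ℝ → ℝ} {s₀ s₁ s₂ B κ : ℝ} (hs₁ : s₁ ≤ s₀) (hκ : κ < 2)
    (hder : ∀ s < s₁, HasDerivAt G (-(G s) / (s₀ - s) - I s / (2 * (s₀ - s))) s)
    (hG : ∀ s < s₁, 0 ≤ G s) (hI : ∀ s < s₁, -κ * G s ≤ I s) (hB : ∀ s < s₂, |G s| ≤ B) :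
    ∀ s < s₁, G s = 0 := by
  set β : ℝ := 1 - κ / 2 with hβ
  have hβ0 : 0 < β := by rw [hβ]; linarith
  have hpos : ∀ σ < s₁, 0 < s₀ - σ := fun σ hσ => by linarith
  -- `Φ σ = G σ · (s₀ − σ)^(−β)` and its derivative
  set Φ : ℝ → ℝ := fun σ => G σ * (s₀ - σ) ^ (-β) with hΦ
  have hderiv : ∀ σ < s₁, HasDerivAt Φ
      ((-(G σ) / (s₀ - σ) - I σ / (2 * (s₀ - σ))) * (s₀ - σ) ^ (-β) + G σ * (-1 * (-β) * (s₀ - σ) ^ (-β - 1))) σ := by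
    intro σ hσ
    have hd : HasDerivAt (fun τ : ℝ => s₀ - τ) (-1) σ := by simpa using (hasDerivAt_id σ).const_sub s₀
    have hp : HasDerivAt (fun τ : ℝ => (s₀ - τ) ^ (-β)) (-1 * (-β) * (s₀ - σ) ^ (-β - 1)) σ :=
      hd.rpow_const (Or.inl (hpos σ hσ).ne')
    exact (hder σ hσ).mul hp
  have hderiv_nonpos : ∀ σ < s₁,
      (-(G σ) / (s₀ - σ) - I σ / (2 * (s₀ - σ))) * (s₀ - σ) ^ (-β) + G σ * (-1 * (-β) * (s₀ - σ) ^ (-β - 1)) ≤ 0 := by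
    intro σ hσ
    have hq : 0 < s₀ - σ := hpos σ hσ
    have hrpow : (s₀ - σ) ^ (-β - 1) = (s₀ - σ) ^ (-β) / (s₀ - σ) := by
      rw [show (-β - 1 : ℝ) = -β + (-1) by ring, Real.rpow_add hq, Real.rpow_neg_one, div_eq_mul_inv]
    rw [hrpow]
    have hpβ : 0 < (s₀ - σ) ^ (-β) := Real.rpow_pos_of_pos hq _
    -- `G' ≤ −βG/(s₀−σ)` from `I ≥ −κG`
    have h1 : -(G σ) / (s₀ - σ) - I σ / (2 * (s₀ - σ)) ≤ -β * G σ / (s₀ - σ) := by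
      have hI' := hI σ hσ
      have e1 : -(G σ) / (s₀ - σ) - I σ / (2 * (s₀ - σ)) = (-(2 * G σ) - I σ) / (2 * (s₀ - σ)) := by
        field_simp
      have e2 : -β * G σ / (s₀ - σ) = (-(2 * G σ) + κ * G σ) / (2 * (s₀ - σ)) := by
        rw [hβ]; field_simp; ring
      rw [e1, e2]
      exact div_le_div_of_nonneg_right (by linarith) (by positivity)
    calc (-(G σ) / (s₀ - σ) - I σ / (2 * (s₀ - σ))) * (s₀ - σ) ^ (-β) + G σ * (-1 * (-β) * ((s₀ - σ) ^ (-β) / (s₀ - σ)))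
        ≤ (-β * G σ / (s₀ - σ)) * (s₀ - σ) ^ (-β) + G σ * (-1 * (-β) * ((s₀ - σ) ^ (-β) / (s₀ - σ))) :=
          add_le_add (mul_le_mul_of_nonneg_right h1 hpβ.le) le_rfl
      _ = 0 := by field_simp; ring
  have hanti : AntitoneOn Φ (Iio s₁) := by
    have hdiff : ∀ σ ∈ Iio s₁, DifferentiableAt ℝ Φ σ := fun σ hσ => (hderiv σ hσ).differentiableAt
    refine antitoneOn_of_deriv_nonpos (convex_Iio s₁) ?_ ?_ ?_
    · exact fun σ hσ => (hdiff σ hσ).continuousAt.continuousWithinAt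
    · rw [interior_Iio]
      exact fun σ hσ => (hdiff σ hσ).differentiableWithinAt
    · rw [interior_Iio]
      intro σ hσ
      rw [(hderiv σ hσ).deriv]
      exact hderiv_nonpos σ hσ
  -- `Φ ≥ 0`, non-increasing, `Φ ≤ B (s₀−σ)^{−β}` far back ⇒ `Φ ≡ 0`
  intro s hs
  have hs0 : 0 < s₀ - s := hpos s hs
  by_contra hne
  have hGpos : 0 < G s := lt_of_le_of_ne (hG s hs) (Ne.symm hne)
  have hΦpos : 0 < Φ s := mul_pos hGpos (Real.rpow_pos_of_pos hs0 _)
  have hBnn : 0 ≤ B := le_trans (abs_nonneg _) (hB (s₂ - 1) (by linarith))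
  -- a far-back time `s'` with `B (s₀ − s')^{−β} < Φ s`
  set M : ℝ := (B / Φ s + 1) ^ (1 / β) with hM
  have hM0 : 0 ≤ M := Real.rpow_nonneg (by positivity) _
  set s' : ℝ := min (min s s₂) (s₀ - M) - 1 with hs'
  have hs's : s' < s := by
    have : min (min s s₂) (s₀ - M) ≤ s := (min_le_left _ _).trans (min_le_left _ _)
    rw [hs']; linarith
  have hs'₂ : s' < s₂ := by
    have : min (min s s₂) (s₀ - M) ≤ s₂ := (min_le_left _ _).trans (min_le_right _ _)
    rw [hs']; linarith
  have hs'₁ : s' < s₁ := hs's.trans hs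
  have hgap : M < s₀ - s' := by
    have : min (min s s₂) (s₀ - M) ≤ s₀ - M := min_le_right _ _
    rw [hs']; linarith
  have hq' : 0 < s₀ - s' := hM0.trans_lt hgap
  -- `(s₀ − s')^β > B/Φ s + 1`
  have hpow : B / Φ s + 1 < (s₀ - s') ^ β := by
    have h1 : M ^ β = B / Φ s + 1 := by
      rw [hM, ← Real.rpow_mul (by positivity), one_div_mul_cancel hβ0.ne', Real.rpow_one]
    rw [← h1]
    exact Real.rpow_lt_rpow hM0 hgap hβ0
  -- `Φ s ≤ Φ s' ≤ B (s₀−s')^{−β} < Φ s`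
  have hmono : Φ s ≤ Φ s' := hanti (show s' ∈ Iio s₁ from hs'₁) (show s ∈ Iio s₁ from hs) hs's.le
  have hΦs' : Φ s' ≤ B * (s₀ - s') ^ (-β) := by
    have hGle : G s' ≤ B := (le_abs_self _).trans (hB s' hs'₂)
    exact mul_le_mul_of_nonneg_right hGle (Real.rpow_nonneg hq'.le _)
  have hlt : B * (s₀ - s') ^ (-β) < Φ s := by
    rw [Real.rpow_neg hq'.le, ← div_eq_mul_inv, div_lt_iff₀ (Real.rpow_pos_of_pos hq' _)]
    have h2 : Φ s * (B / Φ s + 1) < Φ s * (s₀ - s') ^ β := mul_lt_mul_of_pos_left hpow hΦpos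
    have h3 : Φ s * (B / Φ s + 1) = B + Φ s := by field_simp
    linarith
  linarith

/-- **CENSUS ROW R_κ — SUB-EXTREMAL INFLOW.**  A closed-hemisphere door-class profile for which, about ONE space–time axis `(x₀, s₀)`
and before some epoch `s₁ < min(0, s₀)`, the Gaussian inflow correlation obeys `ℐ(s₀−s; x₀)[v(s)] ≥ −κ·𝒢(s₀−s; x₀)[v(s)]` with a
constant `κ < 2`, is poloidal on the whole slab.  (`κ = 0` is the rung R `noInflowStratum_holds`; `κ = 2` is attained by the
Gaussian-extremal normal form of every enemy.) -/
theorem poloidal_of_subExtremalInflow {v : ℝ → EuclideanSpace ℝ (Fin 3) → EuclideanSpace ℝ (Fin 3)} (hv : InDoorClass C v)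
    (hsign : SignE3 v) {x₀ : EuclideanSpace ℝ (Fin 3)} {s₀ s₁ κ : ℝ} (hs₁ : s₁ < 0) (hs₁₀ : s₁ < s₀) (hκ : κ < 2)
    (hI : ∀ s < s₁, -κ * gaussAngMom (s₀ - s) x₀ (v s) ≤ gaussInflow (s₀ - s) x₀ (v s)) :
    ∀ s < 0, ∀ y, ⟪curl (v s) y, e3⟫ = 0 := by
  obtain ⟨B, s₂, -, -, hB⟩ := gaussianBound_holds C v hv x₀ s₀
  have hzero : ∀ s < s₁, gaussAngMom (s₀ - s) x₀ (v s) = 0 :=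
    farPast_eq_zero_of_ratio (G := fun σ => gaussAngMom (s₀ - σ) x₀ (v σ)) (I := fun σ => gaussInflow (s₀ - σ) x₀ (v σ))
      hs₁₀.le hκ (fun s hs => gaussianSwirlLaw_holds C v hv x₀ s₀ s (lt_trans hs hs₁) (lt_trans hs hs₁₀))
      (fun s hs => (gaussianCirculation_holds C v hv hsign x₀ (s₀ - s) s (by linarith) (lt_trans hs hs₁)).1)
      hI hB
  have hfar : ∀ τ < s₁, ∀ y, ⟪curl (v τ) y, e3⟫ = 0 := fun τ hτ =>
    (gaussianCirculation_holds C v hv hsign x₀ (s₀ - τ) τ (by linarith) (lt_trans hτ hs₁)).2 (hzero τ hτ)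
  exact inner_curl_e3_eq_zero_of_far_past hv.1 hv.2.1 hv.2.2.1 hs₁ hfar

/-- **R_κ in the unbundled vocabulary of `HemisphereLiouvilleE3`.** -/
theorem inner_curl_e3_eq_zero_of_subExtremalInflow {v : ℝ → EuclideanSpace ℝ (Fin 3) → EuclideanSpace ℝ (Fin 3)}
    (hrate : HasTypeITimeDecay C v) (hcont : ContinuousOn (uncurry v) (Iio (0 : ℝ) ×ˢ univ))
    (hmild : ∀ s t : ℝ, s < t → t < 0 → ∀ x,
      v t x = UnboundedOperators.heatExtension (v s) (t - s) x - oseenDuhamel 1 s v v t x)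
    (hdiv : ∀ t < 0, VectorCalculus.IsDivFree (v t)) (hsign : ∀ s < 0, ∀ y, 0 ≤ ⟪curl (v s) y, e3⟫)
    {x₀ : EuclideanSpace ℝ (Fin 3)} {s₀ s₁ κ : ℝ} (hs₁ : s₁ < 0) (hs₁₀ : s₁ < s₀) (hκ : κ < 2)
    (hI : ∀ s < s₁, -κ * gaussAngMom (s₀ - s) x₀ (v s) ≤ gaussInflow (s₀ - s) x₀ (v s)) :
    ∀ s < 0, ∀ y, ⟪curl (v s) y, e3⟫ = 0 :=
  poloidal_of_subExtremalInflow ⟨hrate, hcont, hmild, hdiv⟩ hsign hs₁ hs₁₀ hκ hI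

/-- **THE ENEMY'S INFLOW RATIO DIPS BELOW EVERY LEVEL ABOVE `−2`, ABOUT EVERY AXIS, INFINITELY OFTEN IN THE FAR PAST.**  For a
circulation-carrying closed-hemisphere door-class profile (an enemy of W6), every space–time axis `(x₀, s₀)`, every epoch
`s₁ < min(0,s₀)` and every `κ < 2` admit a time `s < s₁` with `ℐ(s₀−s; x₀)[v(s)] < −κ·𝒢(s₀−s; x₀)[v(s)]`. -/
theorem enemy_inflowRatio_dips {v : ℝ → EuclideanSpace ℝ (Fin 3) → EuclideanSpace ℝ (Fin 3)} (hv : InDoorClass C v)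
    (hsign : SignE3 v) (hpos : ∃ s < 0, ∃ y, 0 < ⟪curl (v s) y, e3⟫)
    (x₀ : EuclideanSpace ℝ (Fin 3)) {s₀ s₁ κ : ℝ} (hs₁ : s₁ < 0) (hs₁₀ : s₁ < s₀) (hκ : κ < 2) :
    ∃ s < s₁, gaussInflow (s₀ - s) x₀ (v s) < -κ * gaussAngMom (s₀ - s) x₀ (v s) := by
  by_contra hcon
  push Not at hcon
  obtain ⟨s, hs, y, hy⟩ := hpos
  have h := poloidal_of_subExtremalInflow hv hsign hs₁ hs₁₀ hκ hcon s hs y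
  exact hy.ne' h

end Summit.NavierStokesRegularity.NavierStokesRegularity.Theorems.HalfSpaceWindowDoorCirculationCarryingRigidityGaussSubExtremal

end
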